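import Literature.Analysis.FluidPDE.RusinSverakSingularityStability
import HarnessLib

/-!
# The unforced one-scale ε-regularity criterion from Lemarié-Rieusset's Thm. 14.4, and the
Rusin–Šverák facts **B**, **L**, **S** over the leaves `K`, `P2`, `Thm. 14.4`

Analysis/FluidPDE proof file (no new definitions, no new named facts). The reductions of
`RusinSverakBackwardRegularity.lean` (**B**) and `RusinSverakSingularityStability.lean` (**L**,
**S**) consume the ε-regularity theory only through the **unforced one-scale shape**

  `∃ ε₀ > 0, ∀ (u, p) suitable (ν = 1, f = 0) on O, ∀ Q_r(z) ⋐ O,`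
  `C(r; z) + D(r; z) ≤ ε₀ ⟹ u ∈ L^∞(Q_{r/2}(z))`

(`C = cknC`, `D = cknD`), which `oneScaleRegularity` (Caffarelli–Kohn–Nirenberg 1982, Prop. 1,
`CKNEpsilonRegularityAssembly.lean`) supplies through `oneScaleRegularity.unforced`. This file
proves that the other ε-regularity leaf of the tree, Lemarié-Rieusset's **Thm. 14.4**
(`lemarieRieusset_epsilon_regularity`, `CKNEpsilonRegularity.lean`: on a domain `Ω` carrying the
global classes `u ∈ L^∞L² ∩ L²Ḣ¹(Ω)`, `p ∈ L^{3/2}(Ω)`, `f ∈ L^q(Ω)`, smallness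
`∫∫_{Q_{r₀}} (|u|³ + |p|^{3/2}) ≤ λ³ r₀²`, `λ ≤ ε₀`, bounds `|u|` by `C₀λ/r₀` on `Q_{r₀/2}`), supplies
it as well (`lemarieRieusset_epsilon_regularity.unforced_oneScale`): localise to the open
backward cylinder `Ω = Q_r(z)` itself — convex, hence a domain; its closure is compact in `O`, so
the local classes of `IsSuitableWeakSolutionOn O` are global classes on `Ω` — and take
`λ = ε₀`, the smallness `C + D ≤ ε₀³` being `∫∫_{Q_r}(|u|³ + |p|^{3/2}) ≤ ε₀³ r²`; the force
conditions are void for `f = 0`. Consequently **B**, **L** and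
**S** = `rusin_sverak_leray_singular_points_stable` hold over the leaves
**K** ∧ `seregin_sverak_pressure_decay` ∧ `lemarieRieusset_epsilon_regularity` as well
(`…_of_lemarieRieusset`), i.e. Rusin–Šverák's Prop. 2.1 may be taken in either of its two
catalogued printed forms.

## References

* P. G. Lemarié-Rieusset, *The Navier–Stokes problem in the 21st century* (2016), §14.3,
  Thm. 14.4 (p. 505). [`LemarieRieusset2016`]
* W. Rusin, V. Šverák, J. Funct. Anal. 260 (2011) = arXiv:0911.0500, Prop. 2.1, Lemma 2.1,
  Thm. 4.2 (pp. 4, 7). [`RusinSverak2011`]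
* L. Caffarelli, R. Kohn, L. Nirenberg, CPAM 35 (1982), Prop. 1. [`CaffarelliKohnNirenberg1982`]
-/

noncomputable section

open MeasureTheory Set Function Filter Topology TopologicalSpace Metric
open scoped NNReal ENNReal InnerProductSpace RealInnerProductSpace Laplacian

namespace Literature.Analysis.FluidPDE

/-- Backward parabolic cylinders of positive radius are connected (convex, and nonempty by
`parabolicCylinder_nonempty`, `LocalTypeI.lean`), hence "domains" (private copy of
`isConnected_parabolicCylinder`, `TsaiLocalEnergyProofs.lean`, not imported here). [folklore] -/
private theorem isConnected_parabolicCylinder' {r : ℝ} (hr : 0 < r) (z : ℝ × EuclideanSpace ℝ (Fin 3)) :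
    IsConnected (parabolicCylinder r z) :=
  ⟨parabolicCylinder_nonempty hr z, ((convex_Ioo _ _).prod (convex_ball _ _)).isPreconnected⟩

/-- The closure of a backward cylinder is compact. [folklore] -/
theorem isCompact_closure_parabolicCylinder (r : ℝ) (z : ℝ × EuclideanSpace ℝ (Fin 3)) :
    IsCompact (closure (parabolicCylinder r z)) :=
  (isCompact_Icc.prod (isCompact_closedBall _ _)).of_isClosed_subset isClosed_closure
    (closure_parabolicCylinder_subset r z)

/-- **The unforced one-scale criterion from Lemarié-Rieusset's Thm. 14.4.** There is `ε₀ > 0`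
such that every suitable weak solution `(u, p)` of the unforced unit-viscosity equations on an
open `O` (`IsSuitableWeakSolutionOn O 1 0 u p`) with `C(r; z) + D(r; z) ≤ ε₀` on a cylinder with
`closure Q_r(z) ⊆ O` is essentially bounded on `Q_{r/2}(z)`. Proof: apply Thm. 14.4 with `ν = 1`,
`q = 3`, `f = 0` on the domain `Ω = Q_r(z)` (connected; the global classes on `Ω` are the local
classes on the compact `closure Q_r(z) ⊆ O`), `r₀ = r`, `λ = ε₀(14.4)`, the smallness being
`∫∫_{Q_r}(|u|³ + |p|^{3/2}) ≤ ε₀³ r²`; the bound `|u| ≤ C₀ ε₀ / r` a.e. on `Q_{r/2}` gives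
`u ∈ L^∞(Q_{r/2})`. [cite: LemarieRieusset2016, Thm. 14.4 p. 505] -/
theorem lemarieRieusset_epsilon_regularity.unforced_oneScale (h : lemarieRieusset_epsilon_regularity) :
    ∃ ε₀ : ℝ, 0 < ε₀ ∧ ∀ (O : Opens (ℝ × EuclideanSpace ℝ (Fin 3)))
      (u : ℝ → EuclideanSpace ℝ (Fin 3) → EuclideanSpace ℝ (Fin 3)) (p : ℝ → EuclideanSpace ℝ (Fin 3) → ℝ),
      IsSuitableWeakSolutionOn O 1 0 u p → ∀ (z : ℝ × EuclideanSpace ℝ (Fin 3)) (r : ℝ), 0 < r →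
        closure (parabolicCylinder r z) ⊆ (O : Set (ℝ × EuclideanSpace ℝ (Fin 3))) →
        cknC r z u + cknD r z p ≤ ENNReal.ofReal ε₀ →
        eLpNorm (uncurry u) ∞ (volume.restrict (parabolicCylinder (r / 2) z)) < ∞ := by
  obtain ⟨ε₁, C₀, hε₁, -, H⟩ := h 1 3 one_pos (by norm_num)
  refine ⟨ε₁ ^ 3, by positivity, fun O u p hsws z r hr hcl hsmall => ?_⟩
  -- `K = closure Q_r(z)`, `Ω = Q_r(z)`
  set K : Set (ℝ × EuclideanSpace ℝ (Fin 3)) := closure (parabolicCylinder r z) with hK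
  have hKc : IsCompact K := isCompact_closure_parabolicCylinder r z
  set Ω : Opens (ℝ × EuclideanSpace ℝ (Fin 3)) := parabolicCylinderOpens r z with hΩdef
  have hΩ : (Ω : Set (ℝ × EuclideanSpace ℝ (Fin 3))) = parabolicCylinder r z := rfl
  have hΩK : (Ω : Set (ℝ × EuclideanSpace ℝ (Fin 3))) ⊆ K := subset_closure
  have hΩO' : (Ω : Set (ℝ × EuclideanSpace ℝ (Fin 3))) ⊆ (O : Set (ℝ × EuclideanSpace ℝ (Fin 3))) :=
    hΩK.trans hcl
  have hΩO : Ω ≤ O := hΩO'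
  -- data of the suitable weak solution
  obtain ⟨G, hG, hGL2, hLE⟩ := hsws.localEnergy
  obtain ⟨Cu, hCu⟩ := hsws.energyClass K hcl hKc
  have hpK := hsws.pressure K hcl hKc
  -- the eight hypotheses of Thm. 14.4 on `Ω`
  have hconn : IsConnected (Ω : Set (ℝ × EuclideanSpace ℝ (Fin 3))) := isConnected_parabolicCylinder' hr z
  have hE : ∃ C : ℝ≥0, ∀ᵐ t : ℝ, ∫⁻ x, (Ω : Set (ℝ × EuclideanSpace ℝ (Fin 3))).indicator
      (fun z : ℝ × EuclideanSpace ℝ (Fin 3) => ‖u z.1 z.2‖ₑ ^ 2) (t, x) ≤ C := by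
    refine ⟨Cu, ?_⟩
    filter_upwards [hCu] with t ht
    refine (lintegral_mono fun x => ?_).trans ht
    exact indicator_le_indicator_of_subset hΩK (fun _ => bot_le) _
  have hGΩ : HasWeakSpatialGradientOn Ω u G := hG.mono hΩO
  have hGsq : ∫⁻ w in (Ω : Set (ℝ × EuclideanSpace ℝ (Fin 3))),
      ENNReal.ofReal (frobeniusNormSq (G w.1 w.2)) < ∞ :=
    (lintegral_mono_set hΩK).trans_lt (hGL2 K hcl hKc)
  have hP : ∫⁻ w in (Ω : Set (ℝ × EuclideanSpace ℝ (Fin 3))), ‖p w.1 w.2‖ₑ ^ (3 / 2 : ℝ) < ∞ :=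
    (lintegral_mono_set hΩK).trans_lt hpK
  have hf : MemLp (uncurry (0 : ℝ → EuclideanSpace ℝ (Fin 3) → EuclideanSpace ℝ (Fin 3))) (ENNReal.ofReal 3)
      (volume.restrict (Ω : Set (ℝ × EuclideanSpace ℝ (Fin 3)))) := by
    rw [uncurry_zero]; exact MemLp.zero
  have hdist : IsDistributionalNSSolutionOn Ω 1 0 u p := hsws.distributional.of_le hΩO
  have hLEΩ : ∀ φ : ℝ → EuclideanSpace ℝ (Fin 3) → ℝ, IsSpaceTimeTestOn Ω φ → (∀ t x, 0 ≤ φ t x) →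
      2 * (1 : ℝ) * ∫ t, ∫ x, frobeniusNormSq (G t x) * φ t x ≤
        ∫ t, ∫ x, (‖u t x‖ ^ 2 * (timeDeriv φ t x + 1 * Δ (φ t) x) +
          (‖u t x‖ ^ 2 + 2 * p t x) * ⟪u t x, gradient (φ t) x⟫ +
          2 * ⟪(0 : ℝ → EuclideanSpace ℝ (Fin 3) → EuclideanSpace ℝ (Fin 3)) t x, u t x⟫ * φ t x) :=
    fun φ hφ hφ0 => hLE φ (hφ.mono hΩO) hφ0
  -- smallness in the form (14.17) with `λ = ε₁`
  have hum : AEMeasurable (fun w : ℝ × EuclideanSpace ℝ (Fin 3) => ‖u w.1 w.2‖ₑ ^ (3 : ℕ))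
      (volume.restrict (parabolicCylinder r z)) := by
    have h1 := (hsws.distributional.1.aestronglyMeasurable).mono_measure
      (Measure.restrict_mono hΩO' le_rfl)
    exact h1.aemeasurable.enorm.pow_const 3
  have hr2_0 : ENNReal.ofReal r ^ 2 ≠ 0 := pow_ne_zero _ (ENNReal.ofReal_pos.2 hr).ne'
  have hr2_t : ENNReal.ofReal r ^ 2 ≠ ∞ := ENNReal.pow_ne_top ENNReal.ofReal_ne_top
  have hUP : ∫⁻ w in parabolicCylinder r z, (‖u w.1 w.2‖ₑ ^ (3 : ℕ) + ‖p w.1 w.2‖ₑ ^ (3 / 2 : ℝ)) ≤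
      ENNReal.ofReal (ε₁ ^ 3 * r ^ 2) := by
    set I : ℝ≥0∞ := ∫⁻ w in parabolicCylinder r z, (‖u w.1 w.2‖ₑ ^ (3 : ℕ) + ‖p w.1 w.2‖ₑ ^ (3 / 2 : ℝ))
      with hI
    have h1 : (ENNReal.ofReal r ^ 2)⁻¹ * I ≤ ENNReal.ofReal (ε₁ ^ 3) := by
      rw [hI, lintegral_add_left' hum, mul_add]
      exact hsmall
    calc I = (ENNReal.ofReal r ^ 2 * (ENNReal.ofReal r ^ 2)⁻¹) * I := by
          rw [ENNReal.mul_inv_cancel hr2_0 hr2_t, one_mul]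
      _ = ENNReal.ofReal r ^ 2 * ((ENNReal.ofReal r ^ 2)⁻¹ * I) := mul_assoc _ _ _
      _ ≤ ENNReal.ofReal r ^ 2 * ENNReal.ofReal (ε₁ ^ 3) := mul_le_mul_right h1 _
      _ = ENNReal.ofReal (ε₁ ^ 3 * r ^ 2) := by
          rw [← ENNReal.ofReal_pow hr.le, ← ENNReal.ofReal_mul (by positivity), mul_comm]
  have hF : ∫⁻ w in parabolicCylinder r z,
      ‖(0 : ℝ → EuclideanSpace ℝ (Fin 3) → EuclideanSpace ℝ (Fin 3)) w.1 w.2‖ₑ ^ (3 : ℝ) ≤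
      ENNReal.ofReal (ε₁ ^ (2 * (3 : ℝ)) * r ^ (5 - 3 * (3 : ℝ))) := by
    have : (fun w : ℝ × EuclideanSpace ℝ (Fin 3) =>
        ‖(0 : ℝ → EuclideanSpace ℝ (Fin 3) → EuclideanSpace ℝ (Fin 3)) w.1 w.2‖ₑ ^ (3 : ℝ)) = fun _ => 0 := by
      funext w
      simp [ENNReal.zero_rpow_of_pos (by norm_num : (0 : ℝ) < 3)]
    rw [this, lintegral_zero]
    exact bot_le
  -- Thm. 14.4 on `Ω` at `(z, r, λ = ε₁)`
  have key := H Ω 0 u p G hconn hE hGΩ hGsq hP hf hdist hLEΩ z r ε₁ hr (by rw [hΩ]) hε₁.le le_rfl hUP hF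
  rw [eLpNorm_exponent_top]
  exact eLpNormEssSup_lt_top_of_ae_bound key

/-! ### **B**, **L**, **S** over the leaves `P2` and Thm. 14.4 -/

/-- **B from the pressure decay estimate and Lemarié-Rieusset's Thm. 14.4**
(`isRegularPoint_of_eLpNorm_parabolicCylinder_lt_top_of_unforced` fed by
`lemarieRieusset_epsilon_regularity.unforced_oneScale`).
[cite: RusinSverak2011, Prop. 2.1 (half-open Q_{z₀,r}, arXiv:0911.0500 p. 4); LemarieRieusset2016 Thm. 14.4] -/
theorem isRegularPoint_of_eLpNorm_parabolicCylinder_lt_top_of_lemarieRieusset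
    (hPD : seregin_sverak_pressure_decay) (h14 : lemarieRieusset_epsilon_regularity) :
    isRegularPoint_of_eLpNorm_parabolicCylinder_lt_top :=
  isRegularPoint_of_eLpNorm_parabolicCylinder_lt_top_of_unforced hPD h14.unforced_oneScale

/-- **L (Rusin–Šverák's Lemma 2.1) from the pressure decay estimate and Lemarié-Rieusset's
Thm. 14.4** (`rusin_sverak_stability_of_singularities_of_unforced` fed by
`lemarieRieusset_epsilon_regularity.unforced_oneScale`).
[cite: RusinSverak2011, Lemma 2.1 (arXiv:0911.0500 p. 4); LemarieRieusset2016 Thm. 14.4] -/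
theorem rusin_sverak_stability_of_singularities_of_lemarieRieusset
    (hPD : seregin_sverak_pressure_decay) (h14 : lemarieRieusset_epsilon_regularity) :
    rusin_sverak_stability_of_singularities :=
  rusin_sverak_stability_of_singularities_of_unforced hPD h14.unforced_oneScale

/-- **S (`rusin_sverak_leray_singular_points_stable`, Thm. 4.2 with Lemma 2.1) from K, the pressure
decay estimate and Lemarié-Rieusset's Thm. 14.4**
(`rusin_sverak_leray_singular_points_stable_of_unforced` fed by
`lemarieRieusset_epsilon_regularity.unforced_oneScale`): after this theorem the DAG below **S**
reads **S** ⇐ **K** ∧ **P2** ∧ (`oneScaleRegularity` ∨ `lemarieRieusset_epsilon_regularity`).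
[cite: RusinSverak2011, Thm. 4.2 with Lemma 2.1, proof of Cor. 4.2 (arXiv:0911.0500 pp. 4, 7–8)] -/
theorem rusin_sverak_leray_singular_points_stable_of_lemarieRieusset
    (hK : rusin_sverak_leray_weak_stability) (hPD : seregin_sverak_pressure_decay)
    (h14 : lemarieRieusset_epsilon_regularity) : rusin_sverak_leray_singular_points_stable :=
  rusin_sverak_leray_singular_points_stable_of_unforced hK hPD h14.unforced_oneScale

/-- **Rusin–Šverák's Cor. 4.2 from E, W, R, K, the pressure decay estimate and Thm. 14.4**
(`rusin_sverak_weak_limit_of_singular_points_of_leray_theory` with **S** from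
`rusin_sverak_leray_singular_points_stable_of_lemarieRieusset`).
[cite: RusinSverak2011, Cor. 4.2 and its proof (arXiv:0911.0500 p. 8)] -/
theorem rusin_sverak_weak_limit_of_singular_points_of_lemarieRieusset
    (hE : leray_solution_exists_of_memLp_three) (hW : leray_solution_ae_eq_kato)
    (hR : kato_solution_le_div_sqrt) (hK : rusin_sverak_leray_weak_stability)
    (hPD : seregin_sverak_pressure_decay) (h14 : lemarieRieusset_epsilon_regularity) :
    rusin_sverak_weak_limit_of_singular_points :=
  rusin_sverak_weak_limit_of_singular_points_of_leray_theory hE hW hR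
    (rusin_sverak_leray_singular_points_stable_of_lemarieRieusset hK hPD h14)

end Literature.Analysis.FluidPDE

end
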